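import Literature.Computability.Complexity.ACRealize
import HarnessLib

/-!
# Building constant-depth circuits over an enlarged basis (oracle gates): `ACRealOver`

Trunk T-CPLX-CORE, companion of `ACRealize.lean`. That file's toolkit `ACReal f d s` ("`f` is
computed by the output wire of a well-formed gate list over `acBasis` with `≤ s` gates, the wire
having `acWeight`-depth `≤ d`") is specific to the basis `acBasis = {¬} ∪ {∧ₖ, ∨ₖ}`. Circuits
*with oracle gates* — unbounded fan-in `∧/∨/¬` together with gates for some further Boolean
functions, e.g. the decision functions `D_x : {0,1}^q → {0,1}` of Shaltiel–Viola's Thm. 1.6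
("a circuit of depth `C` and size `(q/ε)^C` with oracle access to the functions `D_x`",
`Literature.Barriers.PneNP.HardnessAmplificationRequiresMajority`, basis `acBasis ∪ decoderGates 𝒟`) —
need the same calculus over an arbitrary basis `B ⊇ acBasis`. This file provides it:

* `ACRealOver B f d s` — `ACReal` with `acBasis` replaced by `B`; `ACReal.toOver`,
  `ACRealOver.basis_mono`, `mono`, `congr`, `toCircuit` (extraction of a `Circuit ι` with
  `IsOver B`, `acDepth ≤ d`, `size ≤ s` computing `f`), `of_circuit`;
* closure under free negation (`ACRealOver.neg`), under **an arbitrary gate `g ∈ B` applied to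
  realized arguments** (`acRealOver_gate`: depth `+ 1`, sizes add `+ 1`; unbounded fan-in
  `∧`/`∨` of a finite family as the instances `acRealOver_forall`, `acRealOver_exists`), and
  under **composition with a realized outer function** (`ACRealOver.comp`: plugging realizations
  of `f₁, …, f_M` of depth `d` into the inputs of a realization of `F : {0,1}^M → {0,1}` of
  depth `d₁` realizes `x ↦ F(f₁ x, …, f_M x)` in depth `d₁ + d`, sizes adding) — the textbook
  substitution of circuits for the inputs of a circuit (Vollmer 1999, §1.2), whose depth
  bookkeeping is the new relocation lemma `GateList.wdepths_append_reloc_le` (the depth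
  companion of `GateList.vals_append_reloc`).

Everything here is proved; Mathlib has no Boolean circuits.

## References

* H. Vollmer, *Introduction to Circuit Complexity* (1999), §1.2 (composition, depth).
* S. Arora, B. Barak, *Computational Complexity: A Modern Approach* (2009), Def. 6.1, Rem. 6.4.
-/

namespace Literature.Computability.Complexity

open Finset GateList

variable {ι : Type*}

namespace GateList

/-! ### Depth of a relocated gate list -/

/-- **Depth relocation lemma** (depth companion of `vals_append_reloc`): appending to `gs` the
program `gs'` relocated behind `gs` with its inputs re-wired along `ρ`, every gate of the second
block has depth at most its depth inside `gs'` plus a bound `Dm` on the depths of the wires `ρ i`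
(Vollmer 1999, §1.2: the depth of a composition is at most the sum of the depths). [cite: Vollmer1999, §1.2] -/
theorem wdepths_append_reloc_le {ι' : Type*} (w : GateFn → ℕ) (gs : List (Gate ι))
    (gs' : List (Gate ι')) (ρ : ι' → ι ⊕ ℕ) (hρ : WiresOK gs.length ρ) (Dm : ℕ)
    (hD : ∀ i, wireDepthOf (wdepths w gs) (ρ i) ≤ Dm) :
    ∃ ds' : List ℕ, wdepths w (gs ++ gs'.map (reloc ρ gs.length)) = wdepths w gs ++ ds' ∧
      ds'.length = gs'.length ∧ ∀ m, ds'.getD m 0 ≤ (wdepths w gs').getD m 0 + Dm := by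
  induction gs' using List.reverseRecOn with
  | nil => exact ⟨[], by simp, rfl, fun m => by simp⟩
  | append_singleton gs' g ih =>
    obtain ⟨ds', hds', hlen, hle⟩ := ih
    -- the depth of the new (relocated) gate
    set e' := w g.fn + univ.sup fun a =>
      wireDepthOf (wdepths w gs ++ ds') (shiftWire ρ gs.length (g.args a)) with he'
    set e := w g.fn + univ.sup fun a => wireDepthOf (wdepths w gs') (g.args a) with he
    have harg : ∀ a, wireDepthOf (wdepths w gs ++ ds') (shiftWire ρ gs.length (g.args a)) ≤
        wireDepthOf (wdepths w gs') (g.args a) + Dm := by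
      intro a
      cases hga : g.args a with
      | inl i =>
        simp only [shiftWire, wireDepthOf_inl, zero_add]
        rw [wireDepthOf_append_of_lt _ _ (ρ i) (fun m hm => by
          rw [length_wdepths]; exact hρ i m hm)]
        exact hD i
      | inr m =>
        simp only [shiftWire, wireDepthOf_inr, List.getD_eq_getElem?_getD]
        rw [List.getElem?_append_right (by rw [length_wdepths]; omega), length_wdepths,
          Nat.add_sub_cancel]
        have := hle m
        rw [List.getD_eq_getElem?_getD] at this
        rw [List.getD_eq_getElem?_getD] at this
        exact this
    have hee' : e' ≤ e + Dm := by
      rw [he', he, add_assoc]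
      refine Nat.add_le_add_left ?_ _
      refine Finset.sup_le fun a _ => (harg a).trans ?_
      exact Nat.add_le_add_right (Finset.le_sup (f := fun a =>
        wireDepthOf (wdepths w gs') (g.args a)) (mem_univ a)) _
    refine ⟨ds' ++ [e'], ?_, by simp [hlen], fun m => ?_⟩
    · rw [List.map_append, List.map_singleton, ← List.append_assoc, wdepths_append_singleton,
        hds', List.append_assoc]
      rfl
    · rw [wdepths_append_singleton]
      change (ds' ++ [e']).getD m 0 ≤ (wdepths w gs' ++ [e]).getD m 0 + Dm
      rcases Nat.lt_trichotomy m gs'.length with hm | rfl | hm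
      · rw [List.getD_eq_getElem?_getD, List.getElem?_append_left (by rw [hlen]; exact hm),
          List.getD_eq_getElem?_getD, List.getElem?_append_left (by rw [length_wdepths]; exact hm)]
        have := hle m
        rwa [List.getD_eq_getElem?_getD, List.getD_eq_getElem?_getD] at this
      · rw [List.getD_eq_getElem?_getD, List.getElem?_append_right (by rw [hlen]), hlen,
          Nat.sub_self, List.getD_eq_getElem?_getD,
          List.getElem?_append_right (by rw [length_wdepths]), length_wdepths, Nat.sub_self]
        simpa using hee'
      · rw [List.getD_eq_getElem?_getD, List.getElem?_eq_none (by simp [hlen]; omega)]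
        simp

end GateList

/-! ### Realizability over a basis, with depth and size -/

/-- `ACRealOver B f d s`: some well-formed gate list over the basis `B` with at most `s` gates has
an output wire of `acWeight`-depth at most `d` (negations free) carrying `f x` on every input `x`
(Vollmer 1999, §1.2: circuits of depth `d` and size `s` over an unbounded fan-in basis with
oracle gates; `ACReal = ACRealOver acBasis`). [cite: Vollmer1999, §1.2] -/
def ACRealOver (B : Set GateFn) (f : (ι → Bool) → Bool) (d s : ℕ) : Prop :=
  ∃ (gs : List (Gate ι)) (o : ι ⊕ ℕ), WF gs ∧ (∀ g ∈ gs, g.fn ∈ B) ∧ OutOK gs.length o ∧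
    gs.length ≤ s ∧ wireDepthOf (wdepths acWeight gs) o ≤ d ∧ ∀ x, wireOf x (vals gs x) o = f x

/-- `ACReal` is `ACRealOver acBasis` (definitional). [folklore] -/
theorem acRealOver_acBasis_iff (f : (ι → Bool) → Bool) (d s : ℕ) :
    ACRealOver acBasis f d s ↔ ACReal f d s := Iff.rfl

/-- A realization over `acBasis` is a realization over every basis containing it. [folklore] -/
theorem ACReal.toOver {B : Set GateFn} {f : (ι → Bool) → Bool} {d s : ℕ} (h : ACReal f d s)
    (hB : acBasis ⊆ B) : ACRealOver B f d s := by
  obtain ⟨gs, o, hwf, hb, ho, hl, hdep, hev⟩ := h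
  exact ⟨gs, o, hwf, fun g hg => hB (hb g hg), ho, hl, hdep, hev⟩

namespace ACRealOver

variable {B B' : Set GateFn} {f g : (ι → Bool) → Bool} {d d' s s' : ℕ}

/-- Monotonicity in the basis. [folklore] -/
theorem basis_mono (h : ACRealOver B f d s) (hBB' : B ⊆ B') : ACRealOver B' f d s := by
  obtain ⟨gs, o, hwf, hb, ho, hl, hdep, hev⟩ := h
  exact ⟨gs, o, hwf, fun g hg => hBB' (hb g hg), ho, hl, hdep, hev⟩

/-- Monotonicity in depth and size. [folklore] -/
theorem mono (h : ACRealOver B f d s) (hd : d ≤ d') (hs : s ≤ s') : ACRealOver B f d' s' := by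
  obtain ⟨gs, o, hwf, hb, ho, hl, hdep, hev⟩ := h
  exact ⟨gs, o, hwf, hb, ho, hl.trans hs, hdep.trans hd, hev⟩

/-- Extensionality in the computed function. [folklore] -/
theorem congr (h : ACRealOver B f d s) (hfg : ∀ x, f x = g x) : ACRealOver B g d s := by
  obtain ⟨gs, o, hwf, hb, ho, hl, hdep, hev⟩ := h
  exact ⟨gs, o, hwf, hb, ho, hl, hdep, fun x => (hev x).trans (hfg x)⟩

/-- **Extraction of a circuit** over `B` with the recorded depth, size and semantics
(Arora–Barak 2009, Rem. 6.4: straight-line programs are circuits). [cite: AroraBarakCC2009, Rem. 6.4] -/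
theorem toCircuit (h : ACRealOver B f d s) :
    ∃ C : Circuit ι, C.IsOver B ∧ C.acDepth ≤ d ∧ C.size ≤ s ∧ C.Computes f := by
  obtain ⟨gs, o, hwf, hb, ho, hl, hdep, hev⟩ := h
  refine ⟨GateList.toCircuit gs o hwf ho, hb, ?_, hl, fun x => ?_⟩
  · change Circuit.depthWith _ acWeight ≤ d
    rw [circuit_depthWith]
    exact hdep
  · rw [circuit_eval]
    exact hev x

/-- **The converse**: a circuit over `B` of `acDepth ≤ d` and size `≤ s` realizes its own
function. [cite: AroraBarakCC2009, Rem. 6.4] -/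
theorem of_circuit (C : Circuit ι) (hB : C.IsOver B) (hd : C.acDepth ≤ d) (hs : C.size ≤ s) :
    ACRealOver B C.eval d s := by
  refine ⟨C.gates, C.output, wf_gates C, hB, C.wf_output, hs, ?_, fun x => ?_⟩
  · have h := circuit_depthWith C acWeight
    change C.acDepth = _ at h
    rw [← h]; exact hd
  · rw [circuit_eval]

/-- **Negation is free**: appending a `¬` gate on the output wire keeps the depth and adds one
gate (requires `¬ ∈ B`). [cite: Vollmer1999, §1.2] -/
theorem neg (h : ACRealOver B f d s) (hnot : GateFn.not ∈ B) :
    ACRealOver B (fun x => !f x) d (s + 1) := by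
  obtain ⟨gs, o, hwf, hb, ho, hl, hdep, hev⟩ := h
  refine ⟨gs ++ [notGate o], Sum.inr gs.length, ?_, ?_, ?_, by simpa using hl, ?_, fun x => ?_⟩
  · exact hwf.append_singleton fun a m h => ho m h
  · intro g hg
    rw [List.mem_append, List.mem_singleton] at hg
    rcases hg with hg | rfl
    · exact hb g hg
    · exact hnot
  · intro m hm
    simp only [Sum.inr.injEq] at hm
    subst hm; simp
  · simp only [wireDepthOf_inr]
    rw [getD_wdepths_append_singleton, notGate_fn, acWeight_not, zero_add]
    refine Finset.sup_le fun a _ => ?_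
    simpa [notGate] using hdep
  · simp only [wireOf_inr]
    rw [vals_append_singleton, List.getD_eq_getElem?_getD,
      List.getElem?_append_right (by simp), length_vals, Nat.sub_self]
    simp [notGate, hev x]

end ACRealOver

/-! ### Applying a gate of the basis to realized arguments -/

/-- Every gate has `acWeight ≤ 1`. [folklore] -/
theorem acWeight_le_one (g : GateFn) : acWeight g ≤ 1 := by
  unfold acWeight; split <;> simp

/-- **A gate of the basis on realized arguments** (Vollmer 1999, §1.2): if each `f j`
(`j : Fin g.1`, the arity of `g ∈ B`) is realized over `B` at depth `d` with `s j` gates, then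
`x ↦ g(f₀ x, …, f_{k-1} x)` is realized over `B` at depth `d + 1` with `∑ⱼ s j + 1` gates: lay
the blocks side by side and add the gate `g` reading their output wires. For `g = ∧ₖ`/`∨ₖ` this
is `acReal_bigGate`; for an oracle gate it is one oracle call. [cite: Vollmer1999, §1.2] -/
theorem acRealOver_gate {B : Set GateFn} (g : GateFn) (hg : g ∈ B)
    {f : Fin g.1 → (ι → Bool) → Bool} {d : ℕ} {s : Fin g.1 → ℕ}
    (h : ∀ j, ACRealOver B (f j) d (s j)) :
    ACRealOver B (fun x => g.2 fun j => f j x) (d + 1) (∑ j, s j + 1) := by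
  choose gs o hwf hB ho hl hdep hev using h
  set bs : List (List (Gate ι) × (ι ⊕ ℕ)) := List.ofFn fun j => (gs j, o j) with hbs
  have hbs_len : bs.length = g.1 := by simp [hbs]
  have hmem : ∀ b ∈ bs, ∃ j, b = (gs j, o j) := by
    intro b hb
    simp only [hbs, List.mem_ofFn] at hb
    obtain ⟨j, rfl⟩ := hb
    exact ⟨j, rfl⟩
  have hO : ∀ b ∈ bs, OutOK b.1.length b.2 := by
    intro b hb; obtain ⟨j, rfl⟩ := hmem b hb; exact ho j
  set G := (parBlocks bs).1 with hG
  set outs := (parBlocks bs).2 with houts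
  have houts_len : outs.length = g.1 := by rw [houts, length_parBlocks_snd, hbs_len]
  let args : Fin g.1 → ι ⊕ ℕ := fun j => outs[j.1]'(by rw [houts_len]; exact j.2)
  have hbsk : ∀ j : Fin g.1, bs[j.1]'(by rw [hbs_len]; exact j.2) = (gs j, o j) := by
    intro j; simp [hbs]
  have hval : ∀ (x : ι → Bool) (j : Fin g.1), wireOf x (vals G x) (args j) = f j x := by
    intro x j
    have := wireOf_parBlocks x bs hO j.1 (by rw [← houts, houts_len]; exact j.2)
      (by rw [hbs_len]; exact j.2)
    rw [hbsk j] at this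
    rw [← hev j x]
    exact this
  have hdepj : ∀ j : Fin g.1, wireDepthOf (wdepths acWeight G) (args j) ≤ d := by
    intro j
    have := wireDepthOf_parBlocks acWeight bs hO j.1 (by rw [← houts, houts_len]; exact j.2)
      (by rw [hbs_len]; exact j.2)
    rw [hbsk j] at this
    rw [show wireDepthOf (wdepths acWeight G) (args j) = _ from this]
    exact hdep j
  have hargsOK : ∀ j : Fin g.1, OutOK G.length (args j) := fun j =>
    outOK_parBlocks bs hO _ (List.getElem_mem _)
  -- the final gate
  let gate : Gate ι := ⟨g.1, g.2, args⟩
  have hgate_fn : gate.fn = g := by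
    rcases g with ⟨k, t⟩
    rfl
  refine ⟨G ++ [gate], Sum.inr G.length, ?_, ?_, ?_, ?_, ?_, fun x => ?_⟩
  · exact (wf_parBlocks bs fun b hb => by obtain ⟨j, rfl⟩ := hmem b hb; exact hwf j).append_singleton
      fun a m hm => hargsOK a m hm
  · intro g' hg'
    rw [List.mem_append, List.mem_singleton] at hg'
    rcases hg' with hg' | rfl
    · exact fn_mem_parBlocks bs (fun b hb => by obtain ⟨j, rfl⟩ := hmem b hb; exact hB j) g' hg'
    · rw [hgate_fn]; exact hg
  · intro m hm
    simp only [Sum.inr.injEq] at hm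
    subst hm; simp
  · rw [List.length_append, List.length_singleton, hG, length_parBlocks_fst]
    simp only [hbs, List.map_ofFn, List.sum_ofFn, Function.comp_def]
    exact Nat.add_le_add_right (Finset.sum_le_sum fun j _ => hl j) 1
  · simp only [wireDepthOf_inr]
    rw [getD_wdepths_append_singleton, hgate_fn, add_comm]
    exact Nat.add_le_add (Finset.sup_le fun a _ => hdepj a) (acWeight_le_one g)
  · simp only [wireOf_inr]
    rw [vals_append_singleton, List.getD_eq_getElem?_getD,
      List.getElem?_append_right (by simp), length_vals, Nat.sub_self]
    simp only [List.getElem?_cons_zero, Option.getD_some]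
    change g.2 (fun j => wireOf x (vals G x) (args j)) = g.2 fun j => f j x
    simp only [hval x]

/-- **Unbounded fan-in conjunction over `B ⊇ acBasis`.** [cite: Vollmer1999, §1.2] -/
theorem acRealOver_forall {B : Set GateFn} (hB : acBasis ⊆ B) {M : ℕ}
    {f : Fin M → (ι → Bool) → Bool} {d : ℕ} {s : Fin M → ℕ}
    (h : ∀ j, ACRealOver B (f j) d (s j)) :
    ACRealOver B (fun x => decide (∀ j, f j x = true)) (d + 1) (∑ j, s j + 1) :=
  acRealOver_gate (GateFn.and M) (hB (and_mem_acBasis M)) h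

/-- **Unbounded fan-in disjunction over `B ⊇ acBasis`.** [cite: Vollmer1999, §1.2] -/
theorem acRealOver_exists {B : Set GateFn} (hB : acBasis ⊆ B) {M : ℕ}
    {f : Fin M → (ι → Bool) → Bool} {d : ℕ} {s : Fin M → ℕ}
    (h : ∀ j, ACRealOver B (f j) d (s j)) :
    ACRealOver B (fun x => decide (∃ j, f j x = true)) (d + 1) (∑ j, s j + 1) :=
  acRealOver_gate (GateFn.or M) (hB (or_mem_acBasis M)) h

/-- Conjunction with a uniform size bound: `M * s + 1` gates. [cite: Vollmer1999, §1.2] -/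
theorem acRealOver_forall_const {B : Set GateFn} (hB : acBasis ⊆ B) {M : ℕ}
    {f : Fin M → (ι → Bool) → Bool} {d s : ℕ} (h : ∀ j, ACRealOver B (f j) d s) :
    ACRealOver B (fun x => decide (∀ j, f j x = true)) (d + 1) (M * s + 1) :=
  (acRealOver_forall hB h).mono le_rfl (by simp)

/-- Disjunction with a uniform size bound: `M * s + 1` gates. [cite: Vollmer1999, §1.2] -/
theorem acRealOver_exists_const {B : Set GateFn} (hB : acBasis ⊆ B) {M : ℕ}
    {f : Fin M → (ι → Bool) → Bool} {d s : ℕ} (h : ∀ j, ACRealOver B (f j) d s) :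
    ACRealOver B (fun x => decide (∃ j, f j x = true)) (d + 1) (M * s + 1) :=
  (acRealOver_exists hB h).mono le_rfl (by simp)

/-- Input literals over any basis: depth `0`, no gate. [cite: Vollmer1999, §1.2] -/
theorem acRealOver_input (B : Set GateFn) (i : ι) : ACRealOver B (fun x : ι → Bool => x i) 0 0 :=
  ⟨[], Sum.inl i, WF.nil, by simp, (fun m h => by cases h), le_rfl, le_rfl, fun _ => rfl⟩

/-- Negated input literals over `B ∋ ¬`: depth `0`, one (free) gate. [cite: Vollmer1999, §1.2] -/
theorem acRealOver_notInput {B : Set GateFn} (hnot : GateFn.not ∈ B) (i : ι) :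
    ACRealOver B (fun x : ι → Bool => !x i) 0 1 :=
  (acRealOver_input B i).neg hnot

/-- Constants over `B ⊇ acBasis`: depth `1`, one gate (`∧₀`/`∨₀`). [cite: Vollmer1999, §1.2] -/
theorem acRealOver_const {B : Set GateFn} (hB : acBasis ⊆ B) (b : Bool) :
    ACRealOver B (fun _ : ι → Bool => b) 1 1 :=
  (acReal_const b).toOver hB

/-! ### Composition: substituting realizations for the inputs of a realization -/

/-- **Composition** (Vollmer 1999, §1.2): if `F : {0,1}^M → {0,1}` is realized over `B` at depth
`d₁` with `s₁` gates and each `f j` (`j : Fin M`) is realized over `B` at depth `d` with `s j`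
gates, then `x ↦ F(f₀ x, …, f_{M-1} x)` is realized over `B` at depth `d₁ + d` with
`s₁ + ∑ⱼ s j` gates: juxtapose the `M` inner blocks and relocate the outer program behind them,
re-wiring its input `j` to the output wire of block `j`. [cite: Vollmer1999, §1.2] -/
theorem ACRealOver.comp {B : Set GateFn} {M : ℕ} {F : (Fin M → Bool) → Bool} {d₁ s₁ : ℕ}
    (hF : ACRealOver B F d₁ s₁) {f : Fin M → (ι → Bool) → Bool} {d : ℕ} {s : Fin M → ℕ}
    (h : ∀ j, ACRealOver B (f j) d (s j)) :
    ACRealOver B (fun x => F fun j => f j x) (d₁ + d) (s₁ + ∑ j, s j) := by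
  obtain ⟨gsF, oF, hwfF, hBF, hoF, hlF, hdepF, hevF⟩ := hF
  choose gs o hwf hB ho hl hdep hev using h
  set bs : List (List (Gate ι) × (ι ⊕ ℕ)) := List.ofFn fun j => (gs j, o j) with hbs
  have hbs_len : bs.length = M := by simp [hbs]
  have hmem : ∀ b ∈ bs, ∃ j, b = (gs j, o j) := by
    intro b hb
    simp only [hbs, List.mem_ofFn] at hb
    obtain ⟨j, rfl⟩ := hb
    exact ⟨j, rfl⟩
  have hO : ∀ b ∈ bs, OutOK b.1.length b.2 := by
    intro b hb; obtain ⟨j, rfl⟩ := hmem b hb; exact ho j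
  set G := (parBlocks bs).1 with hG
  set outs := (parBlocks bs).2 with houts
  have houts_len : outs.length = M := by rw [houts, length_parBlocks_snd, hbs_len]
  let ρ : Fin M → ι ⊕ ℕ := fun j => outs[j.1]'(by rw [houts_len]; exact j.2)
  have hbsk : ∀ j : Fin M, bs[j.1]'(by rw [hbs_len]; exact j.2) = (gs j, o j) := by
    intro j; simp [hbs]
  have hval : ∀ (x : ι → Bool) (j : Fin M), wireOf x (vals G x) (ρ j) = f j x := by
    intro x j
    have := wireOf_parBlocks x bs hO j.1 (by rw [← houts, houts_len]; exact j.2)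
      (by rw [hbs_len]; exact j.2)
    rw [hbsk j] at this
    rw [← hev j x]
    exact this
  have hdepj : ∀ j : Fin M, wireDepthOf (wdepths acWeight G) (ρ j) ≤ d := by
    intro j
    have := wireDepthOf_parBlocks acWeight bs hO j.1 (by rw [← houts, houts_len]; exact j.2)
      (by rw [hbs_len]; exact j.2)
    rw [hbsk j] at this
    rw [show wireDepthOf (wdepths acWeight G) (ρ j) = _ from this]
    exact hdep j
  have hρ : WiresOK G.length ρ := fun j m hm => outOK_parBlocks bs hO _ (List.getElem_mem _) m hm
  have hwfG : WF G := wf_parBlocks bs fun b hb => by obtain ⟨j, rfl⟩ := hmem b hb; exact hwf j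
  obtain ⟨ds', hds', hlen', hle'⟩ := wdepths_append_reloc_le acWeight G gsF ρ hρ d hdepj
  refine ⟨G ++ gsF.map (reloc ρ G.length), shiftWire ρ G.length oF, hwfG.append_reloc hwfF hρ,
    ?_, ?_, ?_, ?_, fun x => ?_⟩
  · intro g' hg'
    rw [List.mem_append, List.mem_map] at hg'
    rcases hg' with hg' | ⟨g₀, hg₀, rfl⟩
    · exact fn_mem_parBlocks bs (fun b hb => by obtain ⟨j, rfl⟩ := hmem b hb; exact hB j) g' hg'
    · rw [reloc_fn]; exact hBF g₀ hg₀
  · intro m hm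
    cases hoF' : oF with
    | inl j =>
      rw [hoF'] at hm
      simp only [shiftWire] at hm
      have := hρ j m hm
      rw [List.length_append]; omega
    | inr m' =>
      rw [hoF'] at hm
      simp only [shiftWire, Sum.inr.injEq] at hm
      have := hoF m' hoF'
      rw [List.length_append, List.length_map]; omega
  · rw [List.length_append, List.length_map, hG, length_parBlocks_fst, add_comm]
    simp only [hbs, List.map_ofFn, List.sum_ofFn, Function.comp_def]
    exact Nat.add_le_add hlF (Finset.sum_le_sum fun j _ => hl j)
  · rw [hds']
    cases hoF' : oF with
    | inl j =>
      simp only [shiftWire]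
      rw [wireDepthOf_append_of_lt _ _ (ρ j) (fun m hm => by rw [length_wdepths]; exact hρ j m hm)]
      exact (hdepj j).trans (Nat.le_add_left _ _)
    | inr m' =>
      simp only [shiftWire, wireDepthOf_inr, List.getD_eq_getElem?_getD]
      rw [List.getElem?_append_right (by rw [length_wdepths]; omega), length_wdepths,
        Nat.add_sub_cancel]
      have h1 := hle' m'
      rw [List.getD_eq_getElem?_getD, List.getD_eq_getElem?_getD] at h1
      refine h1.trans (Nat.add_le_add_right ?_ _)
      have h2 := hdepF
      rw [hoF', wireDepthOf_inr, List.getD_eq_getElem?_getD] at h2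
      exact h2
  · rw [vals_append_reloc G gsF ρ hρ x,
      wireOf_shiftWire x (vals G x) _ (length_vals G x) ρ hρ oF]
    have hx : (fun i => wireOf x (vals G x) (ρ i)) = fun j => f j x := funext (hval x)
    rw [hx]
    exact hevF _

/-- **Composition with a circuit**: plugging realizations of `f₀, …, f_{M-1}` (depth `d`, sizes
`s j`) into the inputs of a circuit `A` on `M` inputs over `B` realizes `x ↦ A(f₀ x, …)` at depth
`A.acDepth + d` with `A.size + ∑ⱼ s j` gates. [cite: Vollmer1999, §1.2] -/
theorem acRealOver_circuit_comp {B : Set GateFn} {M : ℕ} (A : Circuit (Fin M)) (hA : A.IsOver B)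
    {f : Fin M → (ι → Bool) → Bool} {d : ℕ} {s : Fin M → ℕ}
    (h : ∀ j, ACRealOver B (f j) d (s j)) :
    ACRealOver B (fun x => A.eval fun j => f j x) (A.acDepth + d) (A.size + ∑ j, s j) :=
  (ACRealOver.of_circuit A hA le_rfl le_rfl).comp h

end Literature.Computability.Complexity
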